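import Literature.NumberTheory.Automorphic.GL2RSLFactorExistence
import Literature.NumberTheory.Automorphic.RSLFactorGL2AddCharIndependence
import Literature.NumberTheory.Automorphic.WhittakerTwistedJacquet
import Literature.NumberTheory.Automorphic.WhittakerModelsRankLeOneHolds
import Mathlib.MeasureTheory.Integral.Prod
import HarnessLib

/-!
# The Kirillov model of `GL₂(F)` is a model: `v ↦ (a ↦ W_v(d(a, 1)))` is injective
# (Jacquet–Langlands 1970, Props. 2.7 (b) and 2.8 (ii))

Topic `Literature/NumberTheory/Automorphic`; proof file (theorems only: no definition, no named
fact, no instance).  Let `F` be a non-archimedean local field, `ψ` a non-trivial continuous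
additive character, `π` an irreducible smooth representation of `GL₂(F)` on `V` and `Λ ≠ 0` a
`ψ`-Whittaker functional, `W_v(g) = Λ(π(g) v)` (`whittakerModel`).  We PROVE that the
**Kirillov map** `v ↦ (a ↦ W_v(d(a, 1)))` (`d(a, b) = diagGL2 a b`) is injective
(`eq_zero_of_forall_whittakerModel_diagGL2_eq_zero`): a vector all of whose Whittaker values
on the torus `{d(a, 1)}` vanish is `0`.  This is the statement "the map `v → φ_v` is an
injection" of Jacquet–Langlands 1970, Prop. 2.8 (ii) (with `X = V / V'` one-dimensional, i.e.
read through the Whittaker functional, by local multiplicity one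
`rank_whittakerFunctionals_le_one_holds`), the foundation of the Kirillov model; it is the
input of the uniqueness-of-torus-equivariant-functionals proof of the local functional equation
of `L(s, π × χ)` (Jacquet–Langlands 1970, Thm. 2.18 (iv); JPSS 1983, Thm. 2.7 (iii) for
`(n, m) = (2, 1)`).  We follow the printed proof:

* **Prop. 2.7 (b)** (`eq_zero_of_forall_unipotentGL2_apply_eq`): an irreducible smooth `π` with a
  non-zero `ψ`-Whittaker functional has no non-zero vector fixed by all `n(x) = (1 x; 0 1)`.
  Printed argument: the stabiliser `H` of such a `v` is open and contains `N`; an open subgroup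
  contains a lower unipotent `n̄(y₀)`, `y₀ ≠ 0`, hence `w₀ = n(-1/y₀) n̄(y₀) n(-1/y₀)`
  (antidiagonal), hence `w₀ N w₀⁻¹ = N̄`, hence every matrix of determinant `1`
  (`g = n((a-1)/c) n̄(c) n((d-1)/c)` for `c ≠ 0`); so `π(g) v = π(d(det g, 1)) v`, the `π(g) v`
  span `V` (irreducibility) and are all `N`-fixed, on which a `ψ`-Whittaker functional vanishes
  (`ψ ≠ 1`) — contradicting `Λ ≠ 0`.
* **Prop. 2.8 (ii)** (`forall_unipotentGL2_apply_eq_of_forall_mem_ker`): if `v ∈ V(N, ψ_a)` (the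
  kernel of `V → J_{ψ_a}(π)`, `ψ_a = ψ(a ·)`, `twistedJacquet`) for EVERY `a ∈ Fˣ`, then `v` is
  `N`-fixed.  Printed argument (Lemma 2.8.1 and pp. 23–24 of the 1970 notes), carried out on the
  scalar functions `f_μ(x) = μ(π(n(x)) v)`, `μ ∈ V^*`, which are continuous and invariant under a
  ball `𝔭^r` (smoothness): `v ∈ V(N, ψ_a)` gives `∫_{𝔭^ℓ} ψ(-a x) f_μ(x) dx = 0` for all large
  balls `𝔭^ℓ` (`exists_forall_setIntegral_addChar_mul_eq_zero_of_mem_ker`); the condition is stable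
  under `a ↦ a b` for units `b` with `π(d(b, 1)) v = v` (`setIntegral_addChar_mul_dual_apply_unit`), so by
  compactness of the finitely many relevant shells of `a` ONE ball `𝔭^ℓ` serves all `a` with
  `ψ_a` trivial on `𝔭^r` and non-trivial on a given `𝔭^t`; for the other `a` the integral vanishes
  for free; and then **Lemma 2.8.1** (`eq_zero_of_forall_setIntegral_addChar_mul_eq_zero`,
  `forall_add_eq_of_forall_setIntegral_addChar_mul_eq_zero`: a `𝔭^r`-periodic continuous `g` on
  `𝔭^ℓ` all of whose `ψ_a`-coefficients, `a ∈ 𝔭^{c-r}`, vanish is `0` — Fubini and the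
  orthogonality `∫_{𝔭^n} ψ(x y) dx = μ(𝔭^n) 1_{𝔭^{c-n}}(y)`, `setIntegral_primePowBall_addChar_mul`)
  shows that `f_μ` is `𝔭^t`-periodic, for every `t`, i.e. `v` is `N`-fixed.
* **Assembly** (`mem_ker_whittakerTwist_of_apply_diagGL2_eq_zero`,
  `eq_zero_of_forall_whittakerModel_diagGL2_eq_zero`, `kirillov_injective`): `Λ ∘ π(d(a, 1))` is a non-zero
  `ψ_a`-Whittaker functional, so by local multiplicity one every `ψ_a`-Whittaker functional kills
  a vector `v` with `W_v(d(a,1)) = 0` for all `a`, i.e. `v ∈ V(N, ψ_a)`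
  (`whittakerFunctionalsEquivDual`); hence `v` is `N`-fixed, hence `0`.

## References

* H. Jacquet, R. P. Langlands, *Automorphic Forms on GL(2)*, LNM 114 (1970), §2, Prop. 2.7,
  Prop. 2.8 with Lemma 2.8.1 (pp. 20–25 of the authors' retypeset edition, PDF pp. 24–29 of
  `paper:url-fd3fd52cfac2`). [JacquetLanglands1970]
* R. Godement, *Notes on Jacquet–Langlands' theory*, IAS (1970), §1.1–1.2 (Thm. 1: the Kirillov
  model).
* D. Bump, *Automorphic Forms and Representations* (1997), §4.4 (the Kirillov model and the
  uniqueness of Whittaker models for `GL(2)`). [Bump1997]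
-/

noncomputable section

open scoped MatrixGroups NNReal ENNReal Pointwise
open MeasureTheory ValuativeRel Filter Set
  Literature.NumberTheory.GaloisRepresentations.IsNonarchimedeanLocalField

namespace Literature.NumberTheory.Automorphic

/-! ### Part 1: matrices of determinant one are products of upper and lower unipotents -/

section Matrices

variable {F : Type*} [Field F]

/-- The lower unipotent `n̄(y) = (1 0; y 1)` has determinant `1`. [folklore] -/
theorem det_lowerUnipotent_ne_zero (y : F) : Matrix.det !![(1 : F), 0; y, 1] ≠ 0 := by
  rw [Matrix.det_fin_two_of]; simp

/-- `n(α) n̄(c) n(β) = (1 + α c, (1 + α c) β + α; c, c β + 1)`. [folklore] -/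
theorem coe_unipotentGL2_mul_lower_mul_unipotentGL2 (α c β : F) :
    ((((unipotentGL2 α : ↥(upperUnitriangular (Fin 2) F)) : GL (Fin 2) F) *
        Matrix.GeneralLinearGroup.mkOfDetNeZero !![(1 : F), 0; c, 1] (det_lowerUnipotent_ne_zero c) *
        ((unipotentGL2 β : ↥(upperUnitriangular (Fin 2) F)) : GL (Fin 2) F) : GL (Fin 2) F) :
      Matrix (Fin 2) (Fin 2) F) = !![1 + α * c, (1 + α * c) * β + α; c, c * β + 1] := by
  rw [Units.val_mul, Units.val_mul, coe_unipotentGL2, coe_unipotentGL2,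
    Matrix.GeneralLinearGroup.val_mkOfDetNeZero]
  ext i j
  fin_cases i <;> fin_cases j <;> simp [Matrix.mul_apply, Fin.sum_univ_two]

/-- **A matrix of determinant `1` with non-zero lower-left entry is `n(α) n̄(c) n(β)`.**
[folklore] -/
theorem exists_eq_unipotentGL2_mul_lower_mul_unipotentGL2 {g : GL (Fin 2) F}
    (hdet : Matrix.det (g : Matrix (Fin 2) (Fin 2) F) = 1)
    (hc : (g : Matrix (Fin 2) (Fin 2) F) 1 0 ≠ 0) :
    ∃ α β : F, g = ((unipotentGL2 α : ↥(upperUnitriangular (Fin 2) F)) : GL (Fin 2) F) *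
        Matrix.GeneralLinearGroup.mkOfDetNeZero !![(1 : F), 0; (g : Matrix (Fin 2) (Fin 2) F) 1 0, 1]
          (det_lowerUnipotent_ne_zero _) *
        ((unipotentGL2 β : ↥(upperUnitriangular (Fin 2) F)) : GL (Fin 2) F) := by
  set a := (g : Matrix (Fin 2) (Fin 2) F) 0 0 with ha
  set b := (g : Matrix (Fin 2) (Fin 2) F) 0 1 with hb
  set c := (g : Matrix (Fin 2) (Fin 2) F) 1 0 with hc'
  set d := (g : Matrix (Fin 2) (Fin 2) F) 1 1 with hd
  have hdet' : a * d - b * c = 1 := by rw [← hdet, Matrix.det_fin_two]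
  refine ⟨(a - 1) / c, (d - 1) / c, Units.ext ?_⟩
  rw [coe_unipotentGL2_mul_lower_mul_unipotentGL2]
  have h1 : 1 + (a - 1) / c * c = a := by field_simp; ring
  have h2 : (1 + (a - 1) / c * c) * ((d - 1) / c) + (a - 1) / c = b := by
    rw [h1]
    field_simp
    linear_combination hdet'
  have h4 : c * ((d - 1) / c) + 1 = d := by field_simp; ring
  rw [h2, h4, h1]
  exact Matrix.eta_fin_two _

/-- `n̄(1) g` has lower-left entry `g₀₀ + g₁₀`. [folklore] -/
theorem lower_one_mul_apply_one_zero {L₁ : GL (Fin 2) F}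
    (hL₁ : (L₁ : Matrix (Fin 2) (Fin 2) F) = !![(1 : F), 0; 1, 1]) (g : GL (Fin 2) F) :
    ((L₁ * g : GL (Fin 2) F) : Matrix (Fin 2) (Fin 2) F) 1 0 =
      (g : Matrix (Fin 2) (Fin 2) F) 0 0 + (g : Matrix (Fin 2) (Fin 2) F) 1 0 := by
  rw [Units.val_mul, hL₁]
  simp [Matrix.mul_apply, Fin.sum_univ_two]

/-- **An antidiagonal matrix from `N`, one lower unipotent and `N`**: for `c ≠ 0`,
`n(-c⁻¹) n̄(c) n(-c⁻¹) = (0, -c⁻¹; c, 0)`. [folklore] -/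
theorem coe_unipotentGL2_mul_lower_mul_unipotentGL2_of_inv {c : F} (hc : c ≠ 0) :
    ((((unipotentGL2 (-c⁻¹) : ↥(upperUnitriangular (Fin 2) F)) : GL (Fin 2) F) *
        Matrix.GeneralLinearGroup.mkOfDetNeZero !![(1 : F), 0; c, 1] (det_lowerUnipotent_ne_zero c) *
        ((unipotentGL2 (-c⁻¹) : ↥(upperUnitriangular (Fin 2) F)) : GL (Fin 2) F) : GL (Fin 2) F) :
      Matrix (Fin 2) (Fin 2) F) = !![0, -c⁻¹; c, 0] := by
  rw [coe_unipotentGL2_mul_lower_mul_unipotentGL2]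
  have h0 : 1 + -c⁻¹ * c = 0 := by rw [neg_mul, inv_mul_cancel₀ hc, add_neg_cancel]
  have h3 : c * -c⁻¹ + 1 = 0 := by rw [mul_neg, mul_inv_cancel₀ hc, neg_add_cancel]
  rw [h0, zero_mul, zero_add, h3]

/-- **Conjugating `N` by the antidiagonal `w₀ = (0, -c⁻¹; c, 0)` gives `N̄`**: if `w₀` has this
matrix then `w₀ n(x) w₀⁻¹ = n̄(-c² x)`. [folklore] -/
theorem antidiag_mul_unipotentGL2_mul_inv {c : F} (hc : c ≠ 0) {w₀ : GL (Fin 2) F}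
    (hw : (w₀ : Matrix (Fin 2) (Fin 2) F) = !![0, -c⁻¹; c, 0]) (x : F) :
    w₀ * ((unipotentGL2 x : ↥(upperUnitriangular (Fin 2) F)) : GL (Fin 2) F) * w₀⁻¹ =
      Matrix.GeneralLinearGroup.mkOfDetNeZero !![(1 : F), 0; -(c ^ 2 * x), 1]
        (det_lowerUnipotent_ne_zero _) := by
  rw [mul_inv_eq_iff_eq_mul]
  refine Matrix.GeneralLinearGroup.ext fun i j => ?_
  rw [Units.val_mul, Units.val_mul, hw, coe_unipotentGL2, Matrix.GeneralLinearGroup.val_mkOfDetNeZero]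
  have key : c * x = c ^ 2 * x * c⁻¹ := by field_simp
  fin_cases i <;> fin_cases j <;> simp [Matrix.mul_apply, Fin.sum_univ_two, key]

/-- `g = d(det g, 1) · (d(det g, 1)⁻¹ g)` with the second factor of determinant `1`. [folklore] -/
theorem det_diagGL2_det_inv_mul (g : GL (Fin 2) F) :
    Matrix.det (((diagGL2 (Matrix.GeneralLinearGroup.det g) 1)⁻¹ * g : GL (Fin 2) F) :
      Matrix (Fin 2) (Fin 2) F) = 1 := by
  rw [← Matrix.GeneralLinearGroup.val_det_apply, map_mul, map_inv]
  have h : Matrix.GeneralLinearGroup.det (diagGL2 (Matrix.GeneralLinearGroup.det g) (1 : Fˣ)) =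
      Matrix.GeneralLinearGroup.det g := by
    refine Units.ext ?_
    rw [Matrix.GeneralLinearGroup.val_det_apply, coe_diagGL2, Matrix.det_fin_two_of,
      Matrix.GeneralLinearGroup.val_det_apply]
    simp
  rw [h, inv_mul_cancel, Units.val_one]

/-- `(d(b, 1))⁻¹ = d(b⁻¹, 1)`. [folklore] -/
theorem diagGL2_inv_one (b : Fˣ) : (diagGL2 b (1 : Fˣ))⁻¹ = diagGL2 b⁻¹ 1 :=
  inv_eq_of_mul_eq_one_right (by rw [← diagGL2_mul, mul_inv_cancel, mul_one, diagGL2_one])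

end Matrices

/-! ### Part 2: no `N`-fixed vectors in a generic irreducible smooth representation
(Jacquet–Langlands 1970, Prop. 2.7 (b)) -/

section NoFixed

variable {F : Type*} [Field F] [ValuativeRel F] [TopologicalSpace F] [IsNonarchimedeanLocalField F]
  {V : Type*} [AddCommGroup V] [Module ℂ V] (π : Representation ℂ (GL (Fin 2) F) V)

/-- **An open subgroup of `GL₂(F)` containing `N` contains every matrix of determinant `1`**
(Jacquet–Langlands 1970, proof of Prop. 2.7 (b): it contains a lower unipotent `n̄(y₀)`,
`y₀ ≠ 0`, hence the antidiagonal `w₀ = n(-1/y₀) n̄(y₀) n(-1/y₀)`, hence `N̄ = w₀ N w₀⁻¹`, hence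
`SL₂(F)`). [cite: JacquetLanglands1970, Prop. 2.7 (b) (proof)] -/
theorem mem_of_isOpen_of_unipotentGL2_mem {H : Subgroup (GL (Fin 2) F)} (hH : IsOpen (H : Set (GL (Fin 2) F)))
    (hN : ∀ x : F, ((unipotentGL2 x : ↥(upperUnitriangular (Fin 2) F)) : GL (Fin 2) F) ∈ H)
    {g : GL (Fin 2) F} (hg : Matrix.det (g : Matrix (Fin 2) (Fin 2) F) = 1) : g ∈ H := by
  -- the lower unipotents as a continuous one-parameter family
  set L : F → GL (Fin 2) F := fun y =>
    Matrix.GeneralLinearGroup.mkOfDetNeZero !![(1 : F), 0; y, 1] (det_lowerUnipotent_ne_zero y) with hL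
  have hLcont : Continuous L := by
    refine Units.continuous_iff.2 ⟨?_, ?_⟩
    · have h1 : (fun y => ((L y : GL (Fin 2) F) : Matrix (Fin 2) (Fin 2) F)) = fun y => !![(1 : F), 0; y, 1] :=
        funext fun y => Matrix.GeneralLinearGroup.val_mkOfDetNeZero _ _
      change Continuous fun y => ((L y : GL (Fin 2) F) : Matrix (Fin 2) (Fin 2) F)
      rw [h1]
      refine continuous_matrix fun i j => ?_
      fin_cases i <;> fin_cases j
      exacts [continuous_const, continuous_const, continuous_id, continuous_const]
    · have h1 : (fun y => (((L y)⁻¹ : GL (Fin 2) F) : Matrix (Fin 2) (Fin 2) F)) = fun y => !![(1 : F), 0; -y, 1] := by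
        funext y
        have hinv : (L y)⁻¹ = L (-y) := by
          rw [inv_eq_iff_mul_eq_one]
          refine Matrix.GeneralLinearGroup.ext fun i j => ?_
          rw [Units.val_mul, hL, Matrix.GeneralLinearGroup.val_mkOfDetNeZero,
            Matrix.GeneralLinearGroup.val_mkOfDetNeZero, Units.val_one]
          fin_cases i <;> fin_cases j <;> simp [Matrix.mul_apply, Fin.sum_univ_two]
        rw [hinv, hL, Matrix.GeneralLinearGroup.val_mkOfDetNeZero]
      change Continuous fun y => (((L y)⁻¹ : GL (Fin 2) F) : Matrix (Fin 2) (Fin 2) F)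
      rw [h1]
      refine continuous_matrix fun i j => ?_
      fin_cases i <;> fin_cases j
      exacts [continuous_const, continuous_const, continuous_id.neg, continuous_const]
  have hL0 : L 0 = 1 := by
    refine Matrix.GeneralLinearGroup.ext fun i j => ?_
    rw [hL, Matrix.GeneralLinearGroup.val_mkOfDetNeZero, Units.val_one]
    fin_cases i <;> fin_cases j <;> simp
  -- Step 1: some `n̄(y₀)`, `y₀ ≠ 0`, lies in `H`
  have hpre : L ⁻¹' (H : Set (GL (Fin 2) F)) ∈ nhds (0 : F) :=
    hLcont.continuousAt.preimage_mem_nhds (by rw [hL0]; exact hH.mem_nhds H.one_mem)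
  obtain ⟨k, hk⟩ := exists_primePowBall_subset_of_mem_nhds_zero hpre
  obtain ⟨y₀, hy₀0, hy₀⟩ := exists_normAbs_eq_inv_zpow_of_int (F := F) k
  have hy₀H : L y₀ ∈ H := hk (by rw [mem_primePowBall_iff, hy₀])
  -- Step 2: the antidiagonal `w₀`
  set w₀ : GL (Fin 2) F := ((unipotentGL2 (-y₀⁻¹) : ↥(upperUnitriangular (Fin 2) F)) : GL (Fin 2) F) *
    L y₀ * ((unipotentGL2 (-y₀⁻¹) : ↥(upperUnitriangular (Fin 2) F)) : GL (Fin 2) F) with hw₀def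
  have hw₀H : w₀ ∈ H := H.mul_mem (H.mul_mem (hN _) hy₀H) (hN _)
  have hw₀ : (w₀ : Matrix (Fin 2) (Fin 2) F) = !![0, -y₀⁻¹; y₀, 0] :=
    coe_unipotentGL2_mul_lower_mul_unipotentGL2_of_inv hy₀0
  -- Step 3: every lower unipotent lies in `H`
  have hlower : ∀ y : F, L y ∈ H := by
    intro y
    have h := antidiag_mul_unipotentGL2_mul_inv hy₀0 hw₀ (-(y / y₀ ^ 2))
    have hy : -(y₀ ^ 2 * -(y / y₀ ^ 2)) = y := by field_simp
    have hmem : w₀ * ((unipotentGL2 (-(y / y₀ ^ 2)) : ↥(upperUnitriangular (Fin 2) F)) : GL (Fin 2) F) * w₀⁻¹ ∈ H :=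
      H.mul_mem (H.mul_mem hw₀H (hN _)) (H.inv_mem hw₀H)
    rw [h] at hmem
    have hLy : L y = Matrix.GeneralLinearGroup.mkOfDetNeZero !![(1 : F), 0; -(y₀ ^ 2 * -(y / y₀ ^ 2)), 1]
        (det_lowerUnipotent_ne_zero _) := by
      refine Matrix.GeneralLinearGroup.ext fun i j => ?_
      rw [hL, Matrix.GeneralLinearGroup.val_mkOfDetNeZero, Matrix.GeneralLinearGroup.val_mkOfDetNeZero, hy]
    rw [hLy]
    exact hmem
  -- Step 4: matrices of determinant one
  by_cases hc : (g : Matrix (Fin 2) (Fin 2) F) 1 0 = 0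
  · -- multiply by `n̄(1)` to make the lower-left entry non-zero
    set g' : GL (Fin 2) F := L 1 * g with hg'
    have hdet' : Matrix.det (g' : Matrix (Fin 2) (Fin 2) F) = 1 := by
      rw [hg', Units.val_mul, Matrix.det_mul, hg, mul_one, hL, Matrix.GeneralLinearGroup.val_mkOfDetNeZero,
        Matrix.det_fin_two_of]
      ring
    have hc' : (g' : Matrix (Fin 2) (Fin 2) F) 1 0 ≠ 0 := by
      rw [hg', lower_one_mul_apply_one_zero (by rw [hL, Matrix.GeneralLinearGroup.val_mkOfDetNeZero]),
        hc, add_zero]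
      intro h0
      have hd : Matrix.det (g : Matrix (Fin 2) (Fin 2) F) = 0 := by
        rw [Matrix.det_fin_two, h0, hc]; ring
      rw [hg] at hd
      exact one_ne_zero hd
    obtain ⟨α, β, hαβ⟩ := exists_eq_unipotentGL2_mul_lower_mul_unipotentGL2 hdet' hc'
    have hg'H : g' ∈ H := by
      rw [hαβ]
      exact H.mul_mem (H.mul_mem (hN α) (hlower _)) (hN β)
    have : g = (L 1)⁻¹ * g' := by rw [hg', inv_mul_cancel_left]
    rw [this]
    exact H.mul_mem (H.inv_mem (hlower 1)) hg'H
  · obtain ⟨α, β, hαβ⟩ := exists_eq_unipotentGL2_mul_lower_mul_unipotentGL2 hg hc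
    rw [hαβ]
    exact H.mul_mem (H.mul_mem (hN α) (hlower _)) (hN β)

omit [ValuativeRel F] [TopologicalSpace F] [IsNonarchimedeanLocalField F] in
/-- A `ψ`-Whittaker functional vanishes on `N`-fixed vectors when `ψ ≠ 1`. [folklore] -/
theorem whittakerFunctional_apply_eq_zero_of_fixed {ψ : AddChar F Circle} (hψ : ψ ≠ 1)
    {Λ : Module.Dual ℂ V} (hΛ : Λ ∈ whittakerFunctionals π ψ) {u : V}
    (hu : ∀ x : F, π ((unipotentGL2 x : ↥(upperUnitriangular (Fin 2) F)) : GL (Fin 2) F) u = u) :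
    Λ u = 0 := by
  obtain ⟨x, hx⟩ : ∃ x : F, ψ x ≠ 1 := by
    by_contra h
    push Not at h
    exact hψ (DFunLike.ext _ _ fun x => by rw [h x, AddChar.one_apply])
  have h := (mem_whittakerFunctionals_iff Λ).1 hΛ (unipotentGL2 x) u
  rw [hu x, whittakerCharFun_unipotentGL2] at h
  have h' : (1 - ((ψ x : Circle) : ℂ)) * Λ u = 0 := by rw [sub_mul, one_mul, ← h, sub_self]
  exact (mul_eq_zero.1 h').resolve_left (sub_ne_zero.2 (Ne.symm fun h1 => hx (Circle.coe_eq_one.1 h1)))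

/-- **No `N`-fixed vectors** (Jacquet–Langlands 1970, Prop. 2.7 (b)): in an irreducible smooth
representation of `GL₂(F)` carrying a non-zero `ψ`-Whittaker functional (`ψ ≠ 1`), a vector fixed
by all `n(x)` is `0`.  (Loc. cit. shows that an irreducible admissible `π` with a non-zero
`N`-fixed vector is finite-dimensional, hence one-dimensional; here genericity replaces the
dimension count: `π(g) v = π(d(det g, 1)) v` is again `N`-fixed, so `Λ` kills the span of the
`π(g) v`, which is `V`.) [cite: JacquetLanglands1970, Prop. 2.7 (b)] -/
theorem eq_zero_of_forall_unipotentGL2_apply_eq [π.IsIrreducible] (hπ : π.IsSmooth)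
    {ψ : AddChar F Circle} (hψ : ψ ≠ 1) {Λ : Module.Dual ℂ V} (hΛ : Λ ∈ whittakerFunctionals π ψ)
    (hΛ0 : Λ ≠ 0) {v : V}
    (hv : ∀ x : F, π ((unipotentGL2 x : ↥(upperUnitriangular (Fin 2) F)) : GL (Fin 2) F) v = v) :
    v = 0 := by
  by_contra hv0
  -- the stabiliser of `v` contains every matrix of determinant one
  have hfix : ∀ g : GL (Fin 2) F, Matrix.det (g : Matrix (Fin 2) (Fin 2) F) = 1 → π g v = v := fun g hg =>
    (π.mem_stabilizerSubgroup v g).1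
      (mem_of_isOpen_of_unipotentGL2_mem (hπ v) (fun x => (π.mem_stabilizerSubgroup v _).2 (hv x)) hg)
  -- hence `π(g) v = π(d(det g, 1)) v`, an `N`-fixed vector, killed by `Λ`
  have hred : ∀ g : GL (Fin 2) F, π g v = π (diagGL2 (Matrix.GeneralLinearGroup.det g) 1) v := by
    intro g
    have h := hfix _ (det_diagGL2_det_inv_mul g)
    conv_lhs => rw [← mul_inv_cancel_left (diagGL2 (Matrix.GeneralLinearGroup.det g) (1 : Fˣ)) g,
      map_mul, Module.End.mul_apply, h]
  have hkill : ∀ g : GL (Fin 2) F, Λ (π g v) = 0 := by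
    intro g
    rw [hred g]
    set t : Fˣ := Matrix.GeneralLinearGroup.det g with ht
    refine whittakerFunctional_apply_eq_zero_of_fixed π hψ hΛ fun x => ?_
    have hcomm : ((unipotentGL2 x : ↥(upperUnitriangular (Fin 2) F)) : GL (Fin 2) F) * diagGL2 t 1 =
        diagGL2 t 1 * ((unipotentGL2 (((t⁻¹ : Fˣ) : F) * x) : ↥(upperUnitriangular (Fin 2) F)) : GL (Fin 2) F) := by
      rw [diagGL2_mul_unipotentGL2, Units.mul_inv_cancel_left]
    rw [← Module.End.mul_apply, ← map_mul, hcomm, map_mul, Module.End.mul_apply, hv]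
  -- the span of the `π(g) v` is a non-zero subrepresentation, hence everything
  let W : Subrepresentation π :=
    { toSubmodule := Submodule.span ℂ (Set.range fun g : GL (Fin 2) F => π g v)
      apply_mem_toSubmodule := fun g w hw => by
        refine Submodule.span_induction (p := fun w _ => π g w ∈ Submodule.span ℂ (Set.range fun g => π g v))
          ?_ ?_ ?_ ?_ hw
        · rintro _ ⟨h, rfl⟩
          rw [← Module.End.mul_apply, ← map_mul]
          exact Submodule.subset_span ⟨g * h, rfl⟩
        · rw [map_zero]; exact Submodule.zero_mem _
        · intro x y _ _ hx hy
          rw [map_add]; exact Submodule.add_mem _ hx hy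
        · intro c x _ hx
          rw [map_smul]; exact Submodule.smul_mem _ c hx }
  have hvW : v ∈ W.toSubmodule :=
    Submodule.subset_span ⟨1, by change π 1 v = v; rw [map_one, Module.End.one_apply]⟩
  have hWtop : W = ⊤ := by
    rcases IsSimpleOrder.eq_bot_or_eq_top W with h | h
    · exfalso
      have : v ∈ (⊥ : Subrepresentation π).toSubmodule := h ▸ hvW
      exact hv0 ((Submodule.mem_bot ℂ).1 this)
    · exact h
  apply hΛ0
  refine LinearMap.ext fun w => ?_
  have hw : w ∈ W.toSubmodule := by rw [hWtop]; exact Submodule.mem_top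
  rw [LinearMap.zero_apply]
  refine Submodule.span_induction (p := fun w _ => Λ w = 0) ?_ (map_zero Λ) ?_ ?_ hw
  · rintro _ ⟨g, rfl⟩; exact hkill g
  · intro x y _ _ hx hy; rw [map_add, hx, hy, add_zero]
  · intro c x _ hx; rw [map_smul, hx, smul_zero]

end NoFixed

/-! ### Part 3: Whittaker-type coefficients of `x ↦ μ(π(n(x)) v)` and Lemma 2.8.1 -/

section Analysis

variable {F : Type*} [Field F] [ValuativeRel F] [TopologicalSpace F] [IsNonarchimedeanLocalField F]
  {V : Type*} [AddCommGroup V] [Module ℂ V] (π : Representation ℂ (GL (Fin 2) F) V)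

omit [ValuativeRel F] [TopologicalSpace F] [IsNonarchimedeanLocalField F] in
/-- `π(n(x)) w = π(n(x₀)) w` as soon as `n(x - x₀)` stabilises `w`. [folklore] -/
theorem apply_unipotentGL2_eq_of_sub_mem {w : V} {x x₀ : F}
    (h : ((unipotentGL2 (x - x₀) : ↥(upperUnitriangular (Fin 2) F)) : GL (Fin 2) F) ∈
      π.stabilizerSubgroup w) :
    π ((unipotentGL2 x : ↥(upperUnitriangular (Fin 2) F)) : GL (Fin 2) F) w =
      π ((unipotentGL2 x₀ : ↥(upperUnitriangular (Fin 2) F)) : GL (Fin 2) F) w := by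
  rw [π.mem_stabilizerSubgroup] at h
  conv_lhs => rw [show x = x₀ + (x - x₀) by ring, unipotentGL2_add, Subgroup.coe_mul, map_mul,
    Module.End.mul_apply, h]

/-- **The coefficient functions `x ↦ μ(π(n(x)) w)` of a smooth vector are continuous** (indeed
locally constant). [folklore] -/
theorem continuous_dual_apply_unipotentGL2 {w : V} (hw : π.IsSmoothVector w) (μV : Module.Dual ℂ V) :
    Continuous fun x : F => μV (π ((unipotentGL2 x : ↥(upperUnitriangular (Fin 2) F)) : GL (Fin 2) F) w) := by
  refine continuous_iff_continuousAt.2 fun x₀ => ?_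
  have hpre : (fun x : F => ((unipotentGL2 (x - x₀) : ↥(upperUnitriangular (Fin 2) F)) : GL (Fin 2) F)) ⁻¹'
      (π.stabilizerSubgroup w : Set (GL (Fin 2) F)) ∈ nhds x₀ := by
    have hcont : Continuous fun x : F =>
        ((unipotentGL2 (x - x₀) : ↥(upperUnitriangular (Fin 2) F)) : GL (Fin 2) F) :=
      (continuous_subtype_val.comp continuous_unipotentGL2).comp (continuous_id.sub continuous_const)
    refine hcont.continuousAt.preimage_mem_nhds ?_
    have h1 : ((unipotentGL2 (x₀ - x₀) : ↥(upperUnitriangular (Fin 2) F)) : GL (Fin 2) F) = 1 := by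
      rw [sub_self, unipotentGL2_zero, Subgroup.coe_one]
    show (π.stabilizerSubgroup w : Set (GL (Fin 2) F)) ∈
      nhds (((unipotentGL2 (x₀ - x₀) : ↥(upperUnitriangular (Fin 2) F)) : GL (Fin 2) F))
    rw [h1]
    exact hw.mem_nhds (π.stabilizerSubgroup w).one_mem
  refine (continuousAt_const (y := μV (π ((unipotentGL2 x₀ : ↥(upperUnitriangular (Fin 2) F)) :
    GL (Fin 2) F) w))).congr (Filter.eventuallyEq_of_mem hpre fun x hx => ?_)
  exact congrArg μV (apply_unipotentGL2_eq_of_sub_mem π hx).symm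

variable [MeasurableSpace F] [BorelSpace F] (μ : Measure F)

/-- **Translation invariance inside a ball**: `∫_{𝔭^ℓ} φ(x + y) dx = ∫_{𝔭^ℓ} φ(x) dx` for
`y ∈ 𝔭^ℓ` (any `φ`; the ball is a subgroup). [folklore] -/
theorem setIntegral_primePowBall_comp_add_right [μ.IsAddRightInvariant]
    {ℓ : ℤ} {y : F} (hy : y ∈ primePowBall F ℓ) (φ : F → ℂ) :
    ∫ x in primePowBall F ℓ, φ (x + y) ∂μ = ∫ x in primePowBall F ℓ, φ x ∂μ := by
  rw [← integral_indicator (measurableSet_primePowBall ℓ), ← integral_indicator (measurableSet_primePowBall ℓ)]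
  have h : (primePowBall F ℓ).indicator (fun x => φ (x + y)) =
      fun x => (primePowBall F ℓ).indicator φ (x + y) := by
    funext x
    by_cases hx : x ∈ primePowBall F ℓ
    · rw [Set.indicator_of_mem hx, Set.indicator_of_mem (add_mem_primePowBall hx hy)]
    · have hx' : x + y ∉ primePowBall F ℓ := fun h => hx (by
        simpa using add_mem_primePowBall h (neg_mem_primePowBall hy))
      rw [Set.indicator_of_notMem hx, Set.indicator_of_notMem hx']
  rw [h]
  exact integral_add_right_eq_self _ y

variable [μ.IsAddHaarMeasure]

/-- The coefficient integrand `x ↦ ψ(-a x) μ(π(n(x)) w)` of a smooth vector is integrable on every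
ball. [folklore] -/
theorem integrableOn_addChar_mul_dual_apply {ψ : AddChar F Circle} (hψ : Continuous ψ) {w : V}
    (hw : π.IsSmoothVector w) (μV : Module.Dual ℂ V) (a : F) (ℓ : ℤ) :
    IntegrableOn (fun x : F => ((ψ (-(a * x)) : Circle) : ℂ) *
      μV (π ((unipotentGL2 x : ↥(upperUnitriangular (Fin 2) F)) : GL (Fin 2) F) w))
      (primePowBall F ℓ) μ := by
  haveI : T2Space F :=
    (Literature.NumberTheory.GaloisRepresentations.IsNonarchimedeanLocalField.isLocalField F).toT2Space
  refine ContinuousOn.integrableOn_compact (isCompact_primePowBall ℓ) (Continuous.continuousOn ?_)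
  exact (continuous_subtype_val.comp (hψ.comp (continuous_const.mul continuous_id).neg)).mul
    (continuous_dual_apply_unipotentGL2 π hw μV)

/-- **Coefficients of a translate**: `∫_{𝔭^ℓ} ψ(-a x) μ(π(n(x + y)) w) dx =
ψ(a y) ∫_{𝔭^ℓ} ψ(-a x) μ(π(n(x)) w) dx` for `y ∈ 𝔭^ℓ`. [folklore] -/
theorem setIntegral_addChar_mul_dual_apply_add {ψ : AddChar F Circle} (w : V) (μV : Module.Dual ℂ V)
    (a : F) {ℓ : ℤ} {y : F} (hy : y ∈ primePowBall F ℓ) :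
    ∫ x in primePowBall F ℓ, ((ψ (-(a * x)) : Circle) : ℂ) *
        μV (π ((unipotentGL2 x : ↥(upperUnitriangular (Fin 2) F)) : GL (Fin 2) F)
          (π ((unipotentGL2 y : ↥(upperUnitriangular (Fin 2) F)) : GL (Fin 2) F) w)) ∂μ =
      ((ψ (a * y) : Circle) : ℂ) * ∫ x in primePowBall F ℓ, ((ψ (-(a * x)) : Circle) : ℂ) *
        μV (π ((unipotentGL2 x : ↥(upperUnitriangular (Fin 2) F)) : GL (Fin 2) F) w) ∂μ := by
  set φ : F → ℂ := fun x => ((ψ (-(a * x)) : Circle) : ℂ) *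
    μV (π ((unipotentGL2 x : ↥(upperUnitriangular (Fin 2) F)) : GL (Fin 2) F) w) with hφ
  have hpt : ∀ x ∈ primePowBall F ℓ, ((ψ (-(a * x)) : Circle) : ℂ) *
      μV (π ((unipotentGL2 x : ↥(upperUnitriangular (Fin 2) F)) : GL (Fin 2) F)
        (π ((unipotentGL2 y : ↥(upperUnitriangular (Fin 2) F)) : GL (Fin 2) F) w)) =
      ((ψ (a * y) : Circle) : ℂ) * φ (x + y) := by
    intro x _
    simp only [hφ]
    rw [unipotentGL2_add, Subgroup.coe_mul, map_mul π, Module.End.mul_apply, ← mul_assoc, ← Circle.coe_mul,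
      ← AddChar.map_add_eq_mul, show a * y + -(a * (x + y)) = -(a * x) by ring]
  rw [setIntegral_congr_fun (measurableSet_primePowBall ℓ) hpt, integral_const_mul,
    setIntegral_primePowBall_comp_add_right μ hy φ]

/-- **`v ∈ V(N, ψ_a)` kills the `ψ_a`-coefficients of `x ↦ μ(π(n(x)) v)` over all large balls**
(Jacquet–Langlands 1970, Prop. 2.8, "if the integral … vanishes for some integer `n` it vanishes for
all larger integers", applied to the generators `π(n(y)) w - ψ(a y) w` of `V(N, ψ_a)`): there is
`ℓ₀` such that `∫_{𝔭^ℓ} ψ(-a x) μ(π(n(x)) v) dx = 0` for all `ℓ ≤ ℓ₀` and all linear forms `μ`.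
[cite: JacquetLanglands1970, Prop. 2.8 (i) (proof)] -/
theorem exists_forall_setIntegral_addChar_mul_eq_zero_of_mem_ker (hπ : π.IsSmooth) {ψ : AddChar F Circle}
    (hψ : Continuous ψ) (a : F) {v : V}
    (hv : v ∈ Representation.Coinvariants.ker (whittakerTwist π (ψ.mulShift a))) :
    ∃ ℓ₀ : ℤ, ∀ ℓ ≤ ℓ₀, ∀ μV : Module.Dual ℂ V,
      ∫ x in primePowBall F ℓ, ((ψ (-(a * x)) : Circle) : ℂ) *
        μV (π ((unipotentGL2 x : ↥(upperUnitriangular (Fin 2) F)) : GL (Fin 2) F) v) ∂μ = 0 := by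
  rw [ker_whittakerTwist_eq_span] at hv
  refine Submodule.span_induction (p := fun v _ => ∃ ℓ₀ : ℤ, ∀ ℓ ≤ ℓ₀, ∀ μV : Module.Dual ℂ V,
      ∫ x in primePowBall F ℓ, ((ψ (-(a * x)) : Circle) : ℂ) *
        μV (π ((unipotentGL2 x : ↥(upperUnitriangular (Fin 2) F)) : GL (Fin 2) F) v) ∂μ = 0)
    ?_ ?_ ?_ ?_ hv
  · -- generators `π(u) w - ψ_a(u) w`, `u = n(y)`
    rintro _ ⟨⟨u, w⟩, rfl⟩
    set y : F := (((u : GL (Fin 2) F)) : Matrix (Fin 2) (Fin 2) F) 0 1 with hy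
    have hu : u = unipotentGL2 y := (unipotentGL2_entry u).symm
    obtain ⟨ℓ₀, hℓ₀⟩ := exists_mem_primePowBall y
    refine ⟨ℓ₀, fun ℓ hℓ μV => ?_⟩
    have hyℓ : y ∈ primePowBall F ℓ := primePowBall_antitone hℓ hℓ₀
    have hchar : whittakerCharFun (ψ.mulShift a) u = ψ (a * y) := by
      rw [hu, whittakerCharFun_unipotentGL2, AddChar.mulShift_apply]
    -- the two integrands
    set F₁ : F → ℂ := fun x => ((ψ (-(a * x)) : Circle) : ℂ) *
      μV (π ((unipotentGL2 x : ↥(upperUnitriangular (Fin 2) F)) : GL (Fin 2) F)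
        (π ((unipotentGL2 y : ↥(upperUnitriangular (Fin 2) F)) : GL (Fin 2) F) w)) with hF₁
    set F₂ : F → ℂ := fun x => ((ψ (-(a * x)) : Circle) : ℂ) *
      μV (π ((unipotentGL2 x : ↥(upperUnitriangular (Fin 2) F)) : GL (Fin 2) F) w) with hF₂
    have hpt : ∀ x ∈ primePowBall F ℓ, ((ψ (-(a * x)) : Circle) : ℂ) *
        μV (π ((unipotentGL2 x : ↥(upperUnitriangular (Fin 2) F)) : GL (Fin 2) F)
          (π ((u : ↥(upperUnitriangular (Fin 2) F)) : GL (Fin 2) F) w -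
            whittakerCharFun (ψ.mulShift a) u • w)) =
        F₁ x - ((ψ (a * y) : Circle) : ℂ) * F₂ x := by
      intro x _
      simp only [hF₁, hF₂, hchar, map_sub, map_smul, smul_eq_mul]
      rw [hu]
      ring
    have hi1 : IntegrableOn F₁ (primePowBall F ℓ) μ :=
      integrableOn_addChar_mul_dual_apply π μ hψ (hπ _) μV a ℓ
    have hi2 : IntegrableOn F₂ (primePowBall F ℓ) μ :=
      integrableOn_addChar_mul_dual_apply π μ hψ (hπ w) μV a ℓ
    rw [setIntegral_congr_fun (measurableSet_primePowBall ℓ) hpt, integral_sub hi1 (hi2.const_mul _),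
      integral_const_mul, hF₁, setIntegral_addChar_mul_dual_apply_add π μ w μV a hyℓ, sub_self]
  · exact ⟨0, fun ℓ _ μV => by simp⟩
  · rintro v₁ v₂ - - ⟨ℓ₁, h₁⟩ ⟨ℓ₂, h₂⟩
    refine ⟨min ℓ₁ ℓ₂, fun ℓ hℓ μV => ?_⟩
    have hi1 := integrableOn_addChar_mul_dual_apply π μ hψ (hπ v₁) μV a ℓ
    have hi2 := integrableOn_addChar_mul_dual_apply π μ hψ (hπ v₂) μV a ℓ
    simp only [map_add, mul_add]
    rw [integral_add hi1 hi2, h₁ ℓ (hℓ.trans (min_le_left _ _)) μV, h₂ ℓ (hℓ.trans (min_le_right _ _)) μV,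
      add_zero]
  · rintro c v - ⟨ℓ₀, h⟩
    refine ⟨ℓ₀, fun ℓ hℓ μV => ?_⟩
    simp only [map_smul, smul_eq_mul]
    have h' := h ℓ hℓ μV
    have h3 : ∫ x in primePowBall F ℓ, ((ψ (-(a * x)) : Circle) : ℂ) * (c *
        μV (π ((unipotentGL2 x : ↥(upperUnitriangular (Fin 2) F)) : GL (Fin 2) F) v)) ∂μ =
        c * ∫ x in primePowBall F ℓ, ((ψ (-(a * x)) : Circle) : ℂ) *
          μV (π ((unipotentGL2 x : ↥(upperUnitriangular (Fin 2) F)) : GL (Fin 2) F) v) ∂μ := by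
      rw [← integral_const_mul]
      refine setIntegral_congr_fun (measurableSet_primePowBall ℓ) fun x _ => by ring
    rw [h3, h', mul_zero]

/-- **Transport of the coefficients along the unit torus** (Jacquet–Langlands 1970, proof of
Prop. 2.8 (ii), the display with `π((b 0; 0 1))`): if `|b| = 1` and `π(d(b, 1)) v = v` then the
`ψ_{ab}`-coefficient of `x ↦ μ(π(n(x)) v)` over `𝔭^ℓ` is the `ψ_a`-coefficient of
`x ↦ (μ ∘ π(d(b⁻¹, 1)))(π(n(x)) v)` (substitution `x ↦ b⁻¹ x`).
[cite: JacquetLanglands1970, Prop. 2.8 (ii) (proof)] -/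
theorem setIntegral_addChar_mul_dual_apply_unit {ψ : AddChar F Circle} {v : V} (μV : Module.Dual ℂ V)
    (a : F) (ℓ : ℤ) {b : Fˣ} (hb : normAbs F (b : F) = 1) (hfix : π (diagGL2 b 1) v = v) :
    ∫ x in primePowBall F ℓ, ((ψ (-(a * b * x)) : Circle) : ℂ) *
        μV (π ((unipotentGL2 x : ↥(upperUnitriangular (Fin 2) F)) : GL (Fin 2) F) v) ∂μ =
      ∫ x in primePowBall F ℓ, ((ψ (-(a * x)) : Circle) : ℂ) *
        (μV ∘ₗ π (diagGL2 b⁻¹ 1)) (π ((unipotentGL2 x : ↥(upperUnitriangular (Fin 2) F)) : GL (Fin 2) F) v) ∂μ := by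
  have hb0 : (b : F) ≠ 0 := b.ne_zero
  -- the right integrand, as a function on `F`
  set Φ : F → ℂ := fun x => (primePowBall F ℓ).indicator (fun x => ((ψ (-(a * x)) : Circle) : ℂ) *
    (μV ∘ₗ π (diagGL2 b⁻¹ 1)) (π ((unipotentGL2 x : ↥(upperUnitriangular (Fin 2) F)) : GL (Fin 2) F) v)) x
    with hΦ
  have hconj : ∀ x : F, π (diagGL2 b⁻¹ 1) (π ((unipotentGL2 x : ↥(upperUnitriangular (Fin 2) F)) :
      GL (Fin 2) F) v) = π ((unipotentGL2 (((b⁻¹ : Fˣ) : F) * x) : ↥(upperUnitriangular (Fin 2) F)) :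
        GL (Fin 2) F) v := by
    intro x
    rw [← diagGL2_mul_unipotentGL2_mul_inv b⁻¹ x, diagGL2_inv_one, inv_inv, map_mul, map_mul,
      Module.End.mul_apply, Module.End.mul_apply, hfix]
  have hkey : ∀ x : F, Φ ((b : F) * x) = (primePowBall F ℓ).indicator (fun x => ((ψ (-(a * b * x)) : Circle) : ℂ) *
      μV (π ((unipotentGL2 x : ↥(upperUnitriangular (Fin 2) F)) : GL (Fin 2) F) v)) x := by
    intro x
    have hmem : (b : F) * x ∈ primePowBall F ℓ ↔ x ∈ primePowBall F ℓ := by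
      rw [mul_mem_primePowBall_iff (k := 0) (by rw [hb, zpow_zero]), sub_zero]
    by_cases hx : x ∈ primePowBall F ℓ
    · simp only [hΦ, Set.indicator_of_mem (hmem.2 hx), Set.indicator_of_mem hx, LinearMap.comp_apply, hconj,
        Units.inv_mul_cancel_left, mul_assoc a]
    · simp only [hΦ, Set.indicator_of_notMem (fun h => hx (hmem.1 h)), Set.indicator_of_notMem hx]
  rw [← integral_indicator (measurableSet_primePowBall ℓ), ← integral_indicator (measurableSet_primePowBall ℓ)]
  have h := integral_comp_mul_left μ hb0 Φ
  rw [map_inv₀, hb, inv_one, NNReal.coe_one, one_smul] at h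
  rw [← h]
  exact integral_congr_ae (ae_of_all _ fun x => (hkey x).symm)

/-- **Lemma 2.8.1 of Jacquet–Langlands (vanishing form)**: let `ψ` have conductor exponent `c`,
let `g : F → ℂ` be continuous and `𝔭^r`-periodic, and let `ℓ ≤ r`.  If
`∫_{𝔭^ℓ} ψ(-a x) g(x) dx = 0` for every `a ∈ 𝔭^{c-r}`, then `g = 0` on `𝔭^ℓ`.  Printed proof:
Fourier inversion; here in finite form — integrate the hypothesis against `ψ(a x')` over
`a ∈ 𝔭^{c-r}`, exchange the integrals (Fubini on the compact `𝔭^{c-r} × 𝔭^ℓ`) and evaluate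
`∫_{𝔭^{c-r}} ψ(a (x' - x)) da = μ(𝔭^{c-r}) 1_{𝔭^r}(x' - x)` (`setIntegral_primePowBall_addChar_mul`),
which leaves `μ(𝔭^{c-r}) μ(𝔭^r) g(x') = 0`. [cite: JacquetLanglands1970, Lemma 2.8.1] -/
theorem eq_zero_of_forall_setIntegral_addChar_mul_eq_zero {ψ : AddChar F Circle} {c : ℤ}
    (hc : ψ.HasConductorExp c) (hψ : Continuous ψ) {g : F → ℂ} (hg : Continuous g) {r ℓ : ℤ}
    (hℓr : ℓ ≤ r) (hper : ∀ x, ∀ y ∈ primePowBall F r, g (x + y) = g x)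
    (hvan : ∀ a ∈ primePowBall F (c - r),
      ∫ x in primePowBall F ℓ, ((ψ (-(a * x)) : Circle) : ℂ) * g x ∂μ = 0) :
    ∀ x ∈ primePowBall F ℓ, g x = 0 := by
  classical
  haveI : T2Space F :=
    (Literature.NumberTheory.GaloisRepresentations.IsNonarchimedeanLocalField.isLocalField F).toT2Space
  haveI := secondCountableTopology_localField F
  intro x' hx'
  set S : Set F := primePowBall F (c - r) with hS
  set L : Set F := primePowBall F ℓ with hL
  -- the double integral
  set K : F → F → ℂ := fun a x => ((ψ (a * x') : Circle) : ℂ) * (((ψ (-(a * x)) : Circle) : ℂ) * g x)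
    with hK
  have hKcont : Continuous (Function.uncurry K) := by
    refine Continuous.mul ?_ (Continuous.mul ?_ (hg.comp continuous_snd))
    · exact continuous_subtype_val.comp (hψ.comp (continuous_fst.mul continuous_const))
    · exact continuous_subtype_val.comp (hψ.comp (continuous_fst.mul continuous_snd).neg)
  have hKint : Integrable (Function.uncurry K) ((μ.restrict S).prod (μ.restrict L)) := by
    rw [Measure.prod_restrict]
    exact hKcont.continuousOn.integrableOn_compact ((isCompact_primePowBall _).prod (isCompact_primePowBall _))
  -- (1) integrating the hypothesis: the double integral vanishes
  have h1 : ∫ a in S, ∫ x in L, K a x ∂μ ∂μ = 0 := by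
    refine setIntegral_eq_zero_of_forall_eq_zero fun a ha => ?_
    simp only [hK]
    rw [integral_const_mul, hvan a ha, mul_zero]
  -- (2) exchanging: the inner integral over `a` is the orthogonality integral
  have hinner : ∀ x : F, ∫ a in S, K a x ∂μ =
      g x * (if x' - x ∈ primePowBall F r then (μ.real S : ℂ) else 0) := by
    intro x
    have hr : c - (c - r) = r := by ring
    rw [← hr, ← setIntegral_primePowBall_addChar_mul μ hc (c - r) (x' - x), ← integral_const_mul]
    refine setIntegral_congr_fun (measurableSet_primePowBall _) fun a _ => ?_
    simp only [hK]
    rw [← mul_assoc, ← Circle.coe_mul, ← AddChar.map_add_eq_mul,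
      show a * x' + -(a * x) = a * (x' - x) by ring, mul_comm]
  have h2 : ∫ a in S, ∫ x in L, K a x ∂μ ∂μ = (μ.real S : ℂ) * ((μ.real (x' +ᵥ primePowBall F r) : ℂ) * g x') := by
    rw [integral_integral_swap hKint]
    change ∫ x in L, ∫ a in S, K a x ∂μ ∂μ = _
    simp_rw [hinner]
    -- on `L` the integrand is the indicator of `x' + 𝔭^r` times the constant `μ(S) g(x')`
    have hsub : x' +ᵥ primePowBall F r ⊆ L := by
      rintro _ ⟨y, hy, rfl⟩
      exact add_mem_primePowBall hx' (primePowBall_antitone hℓr hy)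
    have hfun : ∀ x ∈ L, g x * (if x' - x ∈ primePowBall F r then (μ.real S : ℂ) else 0) =
        (x' +ᵥ primePowBall F r).indicator (fun _ => (μ.real S : ℂ) * g x') x := by
      intro x _
      by_cases hx : x' - x ∈ primePowBall F r
      · have hmem : x ∈ x' +ᵥ primePowBall F r :=
          ⟨x - x', by simpa using neg_mem_primePowBall hx, by simp⟩
        rw [if_pos hx, Set.indicator_of_mem hmem]
        have hgx : g x = g x' := by
          have := hper x' (x - x') (by simpa using neg_mem_primePowBall hx)
          rwa [add_sub_cancel] at this
        rw [hgx, mul_comm]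
      · have hmem : x ∉ x' +ᵥ primePowBall F r := by
          rintro ⟨y, hy, rfl⟩
          exact hx (by simpa using neg_mem_primePowBall hy)
        rw [if_neg hx, Set.indicator_of_notMem hmem, mul_zero]
    rw [setIntegral_congr_fun (measurableSet_primePowBall ℓ) hfun,
      setIntegral_indicator ((measurableSet_primePowBall r).const_vadd x'),
      Set.inter_eq_self_of_subset_right hsub, setIntegral_const, Complex.real_smul, ← mul_assoc,
      mul_comm ((μ.real _ : ℝ) : ℂ), mul_assoc]
  -- (3) conclude
  rw [h1] at h2
  have hS0 : (μ.real S : ℂ) ≠ 0 := by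
    rw [Ne, Complex.ofReal_eq_zero, measureReal_def, ENNReal.toReal_eq_zero_iff, not_or]
    exact ⟨(addHaar_primePowBall_pos μ _).ne', (measure_primePowBall_lt_top μ _).ne⟩
  have hT0 : (μ.real (x' +ᵥ primePowBall F r) : ℂ) ≠ 0 := by
    rw [Ne, Complex.ofReal_eq_zero, measureReal_def, measure_vadd, ENNReal.toReal_eq_zero_iff, not_or]
    exact ⟨(addHaar_primePowBall_pos μ _).ne', (measure_primePowBall_lt_top μ _).ne⟩
  have := h2.symm
  rw [mul_eq_zero, mul_eq_zero] at this
  rcases this with h | h | h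
  · exact absurd h hS0
  · exact absurd h hT0
  · exact h

/-- **Lemma 2.8.1 of Jacquet–Langlands (periodicity form)**: let `ψ` have conductor exponent
`c`, `g : F → ℂ` continuous and `𝔭^r`-periodic, `ℓ ≤ t ≤ r`.  If the `ψ_a`-coefficients
`∫_{𝔭^ℓ} ψ(-a x) g(x) dx` vanish for all `a ∈ 𝔭^{c-r} ∖ 𝔭^{c-t}` (i.e. `ψ_a` trivial on `𝔭^r` and
non-trivial on `𝔭^t`), then `g` is `𝔭^t`-periodic on `𝔭^ℓ` ("`f` is constant on the cosets of
`𝔭^{-n}` in `𝔭^{-ℓ}`"): apply the vanishing form to `x ↦ g(x + y) - g(x)`, whose coefficients are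
`(ψ(a y) - 1)` times those of `g`. [cite: JacquetLanglands1970, Lemma 2.8.1] -/
theorem forall_add_eq_of_forall_setIntegral_addChar_mul_eq_zero {ψ : AddChar F Circle} {c : ℤ}
    (hc : ψ.HasConductorExp c) (hψ : Continuous ψ) {g : F → ℂ} (hg : Continuous g) {r t ℓ : ℤ}
    (hℓt : ℓ ≤ t) (htr : t ≤ r) (hper : ∀ x, ∀ y ∈ primePowBall F r, g (x + y) = g x)
    (hvan : ∀ a ∈ primePowBall F (c - r), a ∉ primePowBall F (c - t) →
      ∫ x in primePowBall F ℓ, ((ψ (-(a * x)) : Circle) : ℂ) * g x ∂μ = 0) :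
    ∀ x ∈ primePowBall F ℓ, ∀ y ∈ primePowBall F t, g (x + y) = g x := by
  haveI : T2Space F :=
    (Literature.NumberTheory.GaloisRepresentations.IsNonarchimedeanLocalField.isLocalField F).toT2Space
  intro x hx y hy
  have hyℓ : y ∈ primePowBall F ℓ := primePowBall_antitone hℓt hy
  set d : F → ℂ := fun x => g (x + y) - g x with hd
  have hdc : Continuous d := (hg.comp (continuous_id.add continuous_const)).sub hg
  have hdper : ∀ x, ∀ z ∈ primePowBall F r, d (x + z) = d x := by
    intro x z hz
    simp only [hd]
    rw [add_right_comm, hper _ z hz, hper _ z hz]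
  have hgi : ∀ a : F, IntegrableOn (fun x => ((ψ (-(a * x)) : Circle) : ℂ) * g x) (primePowBall F ℓ) μ :=
    fun a => ((continuous_subtype_val.comp (hψ.comp (continuous_const.mul continuous_id).neg)).mul
      hg).continuousOn.integrableOn_compact (isCompact_primePowBall ℓ)
  have hgi' : ∀ a : F, IntegrableOn (fun x => ((ψ (-(a * x)) : Circle) : ℂ) * g (x + y)) (primePowBall F ℓ) μ :=
    fun a => ((continuous_subtype_val.comp (hψ.comp (continuous_const.mul continuous_id).neg)).mul
      (hg.comp (continuous_id.add continuous_const))).continuousOn.integrableOn_compact (isCompact_primePowBall ℓ)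
  -- the coefficients of `d` all vanish
  have hdvan : ∀ a ∈ primePowBall F (c - r),
      ∫ x in primePowBall F ℓ, ((ψ (-(a * x)) : Circle) : ℂ) * d x ∂μ = 0 := by
    intro a ha
    have hshift : ∫ x in primePowBall F ℓ, ((ψ (-(a * x)) : Circle) : ℂ) * g (x + y) ∂μ =
        ((ψ (a * y) : Circle) : ℂ) * ∫ x in primePowBall F ℓ, ((ψ (-(a * x)) : Circle) : ℂ) * g x ∂μ := by
      set φ : F → ℂ := fun x => ((ψ (-(a * x)) : Circle) : ℂ) * g x with hφ
      have hpt : ∀ x ∈ primePowBall F ℓ, ((ψ (-(a * x)) : Circle) : ℂ) * g (x + y) =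
          ((ψ (a * y) : Circle) : ℂ) * φ (x + y) := by
        intro x _
        simp only [hφ]
        rw [← mul_assoc, ← Circle.coe_mul, ← AddChar.map_add_eq_mul,
          show a * y + -(a * (x + y)) = -(a * x) by ring]
      rw [setIntegral_congr_fun (measurableSet_primePowBall ℓ) hpt, integral_const_mul,
        setIntegral_primePowBall_comp_add_right μ hyℓ φ]
    simp only [hd, mul_sub]
    rw [integral_sub (hgi' a) (hgi a), hshift]
    by_cases hat : a ∈ primePowBall F (c - t)
    · -- `ψ(a y) = 1`
      have hay : a * y ∈ primePowBall F c := by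
        have := mul_mem_primePowBall hat hy
        rwa [sub_add_cancel] at this
      rw [hc.1 _ hay, Circle.coe_one, one_mul, sub_self]
    · rw [hvan a ha hat, mul_zero, sub_self]
  have := eq_zero_of_forall_setIntegral_addChar_mul_eq_zero μ hc hψ hdc (hℓt.trans htr) hdper hdvan x hx
  simpa [hd, sub_eq_zero] using this

end Analysis

/-! ### Part 4: Prop. 2.8 (ii) — `v ∈ V(N, ψ_a)` for all `a` forces `v` to be `N`-fixed -/

section Fixed

variable {F : Type*} [Field F] [ValuativeRel F] [TopologicalSpace F] [IsNonarchimedeanLocalField F]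
  {V : Type*} [AddCommGroup V] [Module ℂ V] (π : Representation ℂ (GL (Fin 2) F) V)

/-- **Jacquet–Langlands 1970, Prop. 2.8 (ii) (the analytic core), with measures**: for `π`
smooth, `ψ` continuous of conductor exponent `c` and an additive Haar measure `μ`, if `v` lies in
`V(N, ψ_a) = ker (V → J_{ψ_a}(π))` for every `a ∈ Fˣ`, then `π(n(y)) v = v` for all `y`.
[cite: JacquetLanglands1970, Prop. 2.8 (ii)] -/
theorem forall_unipotentGL2_apply_eq_of_forall_mem_ker_aux [MeasurableSpace F] [BorelSpace F]
    (μ : Measure F) [μ.IsAddHaarMeasure] (hπ : π.IsSmooth) {ψ : AddChar F Circle} (hψ : Continuous ψ)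
    {c : ℤ} (hc : ψ.HasConductorExp c) {v : V}
    (hv : ∀ a : Fˣ, v ∈ Representation.Coinvariants.ker (whittakerTwist π (ψ.mulShift (a : F)))) :
    ∀ y : F, π ((unipotentGL2 y : ↥(upperUnitriangular (Fin 2) F)) : GL (Fin 2) F) v = v := by
  haveI : T2Space F :=
    (Literature.NumberTheory.GaloisRepresentations.IsNonarchimedeanLocalField.isLocalField F).toT2Space
  -- `S = 𝔭^r` fixes `v` through `N`, `U^{N₁}` fixes `v` through the torus
  have hpre : (fun x : F => ((unipotentGL2 x : ↥(upperUnitriangular (Fin 2) F)) : GL (Fin 2) F)) ⁻¹'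
      (π.stabilizerSubgroup v : Set (GL (Fin 2) F)) ∈ nhds (0 : F) := by
    refine (continuous_subtype_val.comp continuous_unipotentGL2).continuousAt.preimage_mem_nhds ?_
    simp only [Function.comp_apply, unipotentGL2_zero, Subgroup.coe_one]
    exact (hπ v).mem_nhds (π.stabilizerSubgroup v).one_mem
  obtain ⟨r, hr⟩ := exists_primePowBall_subset_of_mem_nhds_zero hpre
  have hfixN : ∀ y ∈ primePowBall F r, π ((unipotentGL2 y : ↥(upperUnitriangular (Fin 2) F)) : GL (Fin 2) F) v = v :=
    fun y hy => (π.mem_stabilizerSubgroup v _).1 (hr hy)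
  obtain ⟨N₁, hN₁, hfixT⟩ := exists_unitFiltration_diagGL2_apply_eq π (hπ v)
  -- the coefficient bound `ℓ(a)` for every `a ≠ 0`
  have hcoef : ∀ a : F, ∃ ℓ₀ : ℤ, a ≠ 0 → ∀ ℓ ≤ ℓ₀, ∀ μV : Module.Dual ℂ V,
      ∫ x in primePowBall F ℓ, ((ψ (-(a * x)) : Circle) : ℂ) *
        μV (π ((unipotentGL2 x : ↥(upperUnitriangular (Fin 2) F)) : GL (Fin 2) F) v) ∂μ = 0 := by
    intro a
    by_cases ha : a = 0
    · exact ⟨0, fun h => absurd ha h⟩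
    · obtain ⟨ℓ₀, h⟩ := exists_forall_setIntegral_addChar_mul_eq_zero_of_mem_ker π μ hπ hψ a
        (hv (Units.mk0 a ha))
      exact ⟨ℓ₀, fun _ => h⟩
  choose ℓf hℓf using hcoef
  -- it suffices to treat balls `𝔭^t` with `t ≤ r`
  suffices hmain : ∀ t : ℤ, t ≤ r → ∀ y ∈ primePowBall F t,
      π ((unipotentGL2 y : ↥(upperUnitriangular (Fin 2) F)) : GL (Fin 2) F) v = v by
    intro y
    obtain ⟨t, ht⟩ := exists_mem_primePowBall y
    exact hmain (min t r) (min_le_right _ _) y (primePowBall_antitone (min_le_left _ _) ht)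
  intro t htr
  -- the compact set of relevant `a` and its finite cover by torus orbits
  set C : Set F := primePowBall F (c - r) ∩ (primePowBall F (c - t))ᶜ with hC
  have hCc : IsCompact C := (isCompact_primePowBall _).inter_right (isOpen_primePowBall _).isClosed_compl
  set W : F → Set F := fun a => (fun a' => a⁻¹ * a' - 1) ⁻¹' primePowBall F (N₁ : ℤ) with hW
  have hWo : ∀ a, IsOpen (W a) := fun a =>
    (isOpen_primePowBall _).preimage ((continuous_const.mul continuous_id).sub continuous_const)
  have hC0 : ∀ a ∈ C, a ≠ 0 := by
    rintro a ⟨-, ha⟩ rfl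
    exact ha (zero_mem_primePowBall _)
  have hcover : C ⊆ ⋃ a, W a := by
    intro a ha
    refine Set.mem_iUnion.2 ⟨a, ?_⟩
    change a⁻¹ * a - 1 ∈ primePowBall F (N₁ : ℤ)
    rw [inv_mul_cancel₀ (hC0 a ha), sub_self]
    exact zero_mem_primePowBall _
  obtain ⟨I, hI⟩ := hCc.elim_finite_subcover W hWo hcover
  -- one ball `𝔭^ℓ` serving every relevant `a`
  set ℓ : ℤ := I.fold min t ℓf with hℓ
  have hℓt : ℓ ≤ t := (Finset.fold_min_le t).2 (Or.inl le_rfl)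
  have hℓa : ∀ a ∈ I, ℓ ≤ ℓf a := fun a ha => (Finset.fold_min_le (ℓf a)).2 (Or.inr ⟨a, ha, le_rfl⟩)
  have hq1 : ¬ ((-1 : F) ∈ primePowBall F (N₁ : ℤ)) := by
    rw [mem_primePowBall_iff, normAbs_neg, map_one, zpow_natCast, not_le]
    exact pow_lt_one₀ inv_residueFieldCard_pos.le inv_residueFieldCard_lt_one (by omega)
  intro y hy
  -- test against every linear form
  rw [← sub_eq_zero]
  refine (Module.forall_dual_apply_eq_zero_iff ℂ _).1 fun μV => ?_
  rw [map_sub, sub_eq_zero]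
  set g : F → ℂ := fun x => μV (π ((unipotentGL2 x : ↥(upperUnitriangular (Fin 2) F)) : GL (Fin 2) F) v)
    with hg
  have hgc : Continuous g := continuous_dual_apply_unipotentGL2 π (hπ v) μV
  have hgper : ∀ x, ∀ z ∈ primePowBall F r, g (x + z) = g x := by
    intro x z hz
    simp only [hg]
    rw [unipotentGL2_add, Subgroup.coe_mul, map_mul, Module.End.mul_apply, hfixN z hz]
  have hgvan : ∀ a ∈ primePowBall F (c - r), a ∉ primePowBall F (c - t) →
      ∫ x in primePowBall F ℓ, ((ψ (-(a * x)) : Circle) : ℂ) * g x ∂μ = 0 := by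
    intro a ha hat
    obtain ⟨i, hi⟩ := Set.mem_iUnion.1 (hI ⟨ha, hat⟩)
    obtain ⟨hiI, hai⟩ := Set.mem_iUnion.1 hi
    have hz : i⁻¹ * a - 1 ∈ primePowBall F (N₁ : ℤ) := hai
    have hi0 : i ≠ 0 := by
      rintro rfl
      rw [inv_zero, zero_mul, zero_sub] at hz
      exact hq1 hz
    have hb0 : i⁻¹ * a ≠ 0 := by
      intro h0
      rw [h0, zero_sub] at hz
      exact hq1 hz
    set b : Fˣ := Units.mk0 (i⁻¹ * a) hb0 with hb
    have hbU : b ∈ unitFiltration F N₁ := (mem_unitFiltration_iff_sub_one_mem hN₁ b).2 hz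
    have hab : a = i * (b : F) := by rw [hb, Units.val_mk0, mul_inv_cancel_left₀ hi0]
    simp only [hg]
    rw [hab, setIntegral_addChar_mul_dual_apply_unit π μ μV i ℓ hbU.1 (hfixT b hbU)]
    exact hℓf i hi0 ℓ (hℓa i hiI) _
  have h := forall_add_eq_of_forall_setIntegral_addChar_mul_eq_zero μ hc hψ hgc hℓt htr hgper hgvan 0
    (zero_mem_primePowBall ℓ) y hy
  simpa only [hg, zero_add, unipotentGL2_zero, Subgroup.coe_one, map_one, Module.End.one_apply] using h

/-- **Jacquet–Langlands 1970, Prop. 2.8 (ii)**: for `π` smooth and `ψ` continuous non-trivial, a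
vector lying in `V(N, ψ_a)` (the kernel of `V → J_{ψ_a}(π)`, `ψ_a(x) = ψ(a x)`) for EVERY
`a ∈ Fˣ` is fixed by all `n(y)`.  (In loc. cit.: "if `φ_v` vanishes identically then `v` is fixed
by the operators `π((1 x; 0 1))` for all `x`".) [cite: JacquetLanglands1970, Prop. 2.8 (ii)] -/
theorem forall_unipotentGL2_apply_eq_of_forall_mem_ker (hπ : π.IsSmooth) {ψ : AddChar F Circle}
    (hψ : ψ.IsContinuousNontrivial) {v : V}
    (hv : ∀ a : Fˣ, v ∈ Representation.Coinvariants.ker (whittakerTwist π (ψ.mulShift (a : F)))) :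
    ∀ y : F, π ((unipotentGL2 y : ↥(upperUnitriangular (Fin 2) F)) : GL (Fin 2) F) v = v := by
  letI : MeasurableSpace F := borel F
  haveI : BorelSpace F := ⟨rfl⟩
  haveI : T2Space F :=
    (Literature.NumberTheory.GaloisRepresentations.IsNonarchimedeanLocalField.isLocalField F).toT2Space
  obtain ⟨c, hc⟩ := hψ.exists_hasConductorExp
  exact forall_unipotentGL2_apply_eq_of_forall_mem_ker_aux π Measure.addHaar hπ hψ.1 hc hv

end Fixed

/-! ### Part 5: the Kirillov map is injective -/

section Kirillov

variable {F : Type*} [Field F] [ValuativeRel F] [TopologicalSpace F] [IsNonarchimedeanLocalField F]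
  {V : Type*} [AddCommGroup V] [Module ℂ V] (π : Representation ℂ (GL (Fin 2) F) V)

omit [ValuativeRel F] [TopologicalSpace F] [IsNonarchimedeanLocalField F] in
/-- `ψ_a` is again continuous and non-trivial for `a ∈ Fˣ`. [folklore] -/
theorem isContinuousNontrivial_mulShift [TopologicalSpace F] [IsTopologicalRing F] {ψ : AddChar F Circle}
    (hψ : ψ.IsContinuousNontrivial) (a : Fˣ) : (ψ.mulShift (a : F)).IsContinuousNontrivial := by
  refine ⟨?_, fun h => hψ.2 ?_⟩
  · change Continuous fun x => ψ.mulShift (a : F) x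
    simp only [AddChar.mulShift_apply]
    exact hψ.1.comp (continuous_const.mul continuous_id)
  · refine DFunLike.ext _ _ fun x => ?_
    have hx := DFunLike.congr_fun h (((a⁻¹ : Fˣ) : F) * x)
    rwa [AddChar.mulShift_apply, Units.mul_inv_cancel_left] at hx

/-- **Vanishing on the torus puts `v` in every `V(N, ψ_a)`**: if `π` is irreducible smooth, `Λ ≠ 0`
is a `ψ`-Whittaker functional and `Λ(π(d(a,1)) v) = 0`, then `v ∈ V(N, ψ_a)` — every
`ψ_a`-Whittaker functional is a multiple of `Λ ∘ π(d(a,1))` (local multiplicity one,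
`rank_whittakerFunctionals_le_one_holds`), and `V(N, ψ_a)` is the joint kernel of the
`ψ_a`-Whittaker functionals (`whittakerFunctionalsEquivDual`).  This is how Jacquet–Langlands'
`X = V / V'`-valued Kirillov function `φ_v` is read through `Λ`. [cite: JacquetLanglands1970, Prop. 2.8] -/
theorem mem_ker_whittakerTwist_of_apply_diagGL2_eq_zero [π.IsIrreducible] (hπ : π.IsSmooth)
    {ψ : AddChar F Circle} (hψ : ψ.IsContinuousNontrivial) {Λ : Module.Dual ℂ V}
    (hΛ : Λ ∈ whittakerFunctionals π ψ) (hΛ0 : Λ ≠ 0) {v : V} (a : Fˣ) (hv : Λ (π (diagGL2 a 1) v) = 0) :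
    v ∈ Representation.Coinvariants.ker (whittakerTwist π (ψ.mulShift (a : F))) := by
  set Λa : Module.Dual ℂ V := Λ ∘ₗ π (diagGL2 a 1) with hΛa
  have hΛa_mem := comp_diagGL2_mem_whittakerFunctionals π hΛ a
  have hΛa0 : Λa ≠ 0 := by
    intro h0
    apply hΛ0
    refine LinearMap.ext fun w => ?_
    have hw := LinearMap.congr_fun h0 (π (diagGL2 a 1)⁻¹ w)
    rw [hΛa, LinearMap.comp_apply, ← Module.End.mul_apply, ← map_mul, mul_inv_cancel, map_one,
      Module.End.one_apply] at hw
    rw [hw, LinearMap.zero_apply, LinearMap.zero_apply]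
  -- every `ψ_a`-Whittaker functional is a multiple of `Λa`
  have hrank := rank_whittakerFunctionals_le_one_holds (π := π) (ψ := ψ.mulShift (a : F)) hπ
    (isContinuousNontrivial_mulShift hψ a)
  obtain ⟨v₀, hv₀, hle⟩ := (rank_submodule_le_one_iff _).1 hrank
  have hall : ∀ Λ' ∈ whittakerFunctionals π (ψ.mulShift (a : F)), Λ' v = 0 := by
    intro Λ' hΛ'
    obtain ⟨c₁, hc₁⟩ := Submodule.mem_span_singleton.1 (hle hΛa_mem)
    obtain ⟨c₂, hc₂⟩ := Submodule.mem_span_singleton.1 (hle hΛ')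
    have hc₁0 : c₁ ≠ 0 := by
      rintro rfl
      rw [zero_smul] at hc₁
      exact hΛa0 hc₁.symm
    have hv₀v : v₀ v = 0 := by
      have h1 : c₁ * v₀ v = 0 := by
        have := congrArg (fun L : Module.Dual ℂ V => L v) hc₁
        simp only [LinearMap.smul_apply, smul_eq_mul] at this
        rw [this]
        exact hv
      exact (mul_eq_zero.1 h1).resolve_left hc₁0
    rw [← hc₂, LinearMap.smul_apply, hv₀v, smul_zero]
  -- hence `[v] = 0` in `J_{ψ_a}(π)`
  rw [← Representation.Coinvariants.mk_eq_zero]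
  refine (Module.forall_dual_apply_eq_zero_iff ℂ _).1 fun φ => ?_
  have h := hall _ ((whittakerFunctionalsEquivDual π (ψ.mulShift (a : F))).symm φ).2
  rwa [whittakerFunctionalsEquivDual_symm_apply] at h

/-- **The Kirillov model is a model** (Jacquet–Langlands 1970, Prop. 2.8 (ii): "the map `v → φ_v`
is an injection"): for `π` an irreducible smooth representation of `GL₂(F)`, `ψ` continuous
non-trivial and `Λ ≠ 0` a `ψ`-Whittaker functional, a vector `v` with `W_v(d(a, 1)) =
Λ(π(d(a,1)) v) = 0` for all `a ∈ Fˣ` is `0`.  Proof: `v ∈ V(N, ψ_a)` for all `a`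
(`mem_ker_whittakerTwist_of_apply_diagGL2_eq_zero`), hence `v` is `N`-fixed
(`forall_unipotentGL2_apply_eq_of_forall_mem_ker`, Prop. 2.8 (ii)), hence `v = 0`
(`eq_zero_of_forall_unipotentGL2_apply_eq`, Prop. 2.7 (b)). [cite: JacquetLanglands1970, Prop. 2.8 (ii)] -/
theorem eq_zero_of_forall_whittakerModel_diagGL2_eq_zero [π.IsIrreducible] (hπ : π.IsSmooth)
    {ψ : AddChar F Circle} (hψ : ψ.IsContinuousNontrivial) {Λ : Module.Dual ℂ V}
    (hΛ : Λ ∈ whittakerFunctionals π ψ) (hΛ0 : Λ ≠ 0) {v : V}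
    (hv : ∀ a : Fˣ, whittakerModel π Λ v (diagGL2 a 1) = 0) : v = 0 := by
  have hker : ∀ a : Fˣ, v ∈ Representation.Coinvariants.ker (whittakerTwist π (ψ.mulShift (a : F))) :=
    fun a => mem_ker_whittakerTwist_of_apply_diagGL2_eq_zero π hπ hψ hΛ hΛ0 a (by simpa using hv a)
  have hfix := forall_unipotentGL2_apply_eq_of_forall_mem_ker π hπ hψ hker
  have hψ1 : ψ ≠ 1 := by rw [AddChar.one_eq_zero]; exact hψ.2
  exact eq_zero_of_forall_unipotentGL2_apply_eq π hπ hψ1 hΛ hΛ0 hfix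

/-- **Injectivity of the Kirillov map** `v ↦ (a ↦ W_v(d(a, 1)))`, `Fˣ → ℂ`, for `π` irreducible
smooth and `Λ ≠ 0` a `ψ`-Whittaker functional (`ψ` continuous non-trivial).
[cite: JacquetLanglands1970, Prop. 2.8 (ii)] -/
theorem kirillov_injective [π.IsIrreducible] (hπ : π.IsSmooth) {ψ : AddChar F Circle}
    (hψ : ψ.IsContinuousNontrivial) {Λ : Module.Dual ℂ V} (hΛ : Λ ∈ whittakerFunctionals π ψ)
    (hΛ0 : Λ ≠ 0) :
    Function.Injective fun v : V => fun a : Fˣ => whittakerModel π Λ v (diagGL2 a 1) := by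
  intro v w hvw
  rw [← sub_eq_zero]
  refine eq_zero_of_forall_whittakerModel_diagGL2_eq_zero π hπ hψ hΛ hΛ0 fun a => ?_
  have h := congr_fun hvw a
  simp only at h
  rw [map_sub, Pi.sub_apply, h, sub_self]

end Kirillov

end Literature.NumberTheory.Automorphic

end
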